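import Summits.ResolutionOfSingularities.ResolutionOfSingularities.Theorems.FrobeniusLadderFInjectiveMacaulayficationExceptionalFibreClause
import Summits.ResolutionOfSingularities.ResolutionOfSingularities.Theorems.FrobeniusLadderFInjectiveMacaulayficationLaurentDescentAway
import Summits.ResolutionOfSingularities.ResolutionOfSingularities.Theorems.FrobeniusLadderFInjectiveMacaulayficationFiniteGradedDescent
import Summits.ResolutionOfSingularities.ResolutionOfSingularities.Theorems.FrobeniusLadderFInjectiveMacaulayficationIntegralSubalgebraLocalDim
import Literature.AlgebraicGeometry.Resolution.AffineDomainEquidim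
import Literature.AlgebraicGeometry.Resolution.BlowupChartTransition
import Mathlib.RingTheory.Localization.InvSubmonoid
import HarnessLib

/-!
# G4 assembly modulo the Rees–Veronese interface (crux `FInjectiveMacaulayfication`, line `graded-engine`, §16 H-G4c)

Support file for crux stmt-ResolutionOfSingularities-15315 (`FrobeniusLadder.FInjectiveMacaulayfication`), §16 THE GRADED
ENGINE (CRUX-PLAN w45a v3, line `graded-engine`, registered stub G4 `stub_gradedChartClause`; design memo GRADED-ENGINE.md v2
steps (iii)–(vi), lead seat res-L1-w45a-lead-1; `GradedChartClausePlan.lean` "G4 assembly"). [OURS · L1 W4.5a] — bookkeeping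
over landed route lemmas; not a statement of any manuscript; AI-written, weaker than expert review.

`chartClause_of_reesInterface`: the WEIGHT-FREE assembly of G4. Data: `k` a field of characteristic `p`,
`R = k[X₁, …, Xₙ]/(f)` with `(f)` prime, a variable `x̄_v ≠ 0`, `c > 0`, `u = x̄_v^c`, `L = R[1/u]`, `T' = L[s]`, any ideal
`I ⊆ R` and its blow-up chart `C = R[I/u] ⊆ L`; HYPOTHESES: `hoff` (the clause at the maximal ideals of `R` missing some variable)
and the REES–VERONESE INTERFACE (helper H-G2, to be supplied by the graded engine from the weight data): a `k`-subalgebra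
`A'` of `T'` over which `T'` is integral with an `A'`-linear retraction and with `s^N ∈ A'`; a ring `T₀` with `ι : C ≃+* T₀`; a
ring isomorphism `e : T₀[Y, Y⁻¹] = Localization.Away (Y : T₀[Y]) ≃+* A'` with `e⁻¹(s^N)` in the ideal generated by `ι(u)` (in the engine: `T₀` = the
degree-`0` part of `T'`, `ι(u) = C(u/1)·s^N`, `e|_{T₀}` = inclusion, `e(Y) = C(u/1)`, so `e(ι(u)/Y) = ι(u)·C(u/1)⁻¹ = s^N`). CONCLUSION: the clause (every system of parameters weakly regular,
every parameter ideal Frobenius closed) at every maximal ideal `Q ∋ u` of the chart `C`.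

Proof (GRADED-ENGINE.md v2): `hclB` = the clause on the fibre `s = 0` of `T'` (`ExceptionalFibreClause.exceptionalFibreClause`,
H-G4a); all maximal localisations of the affine domain `T'` have one dimension `m` (`Literature…exists_ringKrullDim_eq_and_trdeg_eq`,
`…ringKrullDim_localization_atPrime_eq_of_isMaximal`), hence so do those of `A'` (`IntegralSubalgebraLocalDim`, p456856); finite
graded descent (`FiniteGradedDescent.stub_finiteGradedDescent`, p173797) gives the clause for `A'` at its maximal ideals containing
`s^N`; for `Q ∋ u` maximal in `C` put `𝔫₀ = ι(Q)`, `𝔑 = 𝔫₀·T₀[Y] + (Y − 1)`, `𝔐 = 𝔑·T₀[Y, Y⁻¹]`, `𝔫' = e(𝔐)` (written `e⁻¹`-preimage) — a maximal ideal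
of `A'` containing `s^N = e((ι u)/Y)` (as `ι u ∈ 𝔫₀`); transport along `e`, Laurent descent (`LaurentDescentAway.laurentDescentAway`, H-G4b) and
transport along `ι` finish. `chartClause_core` / `chartClause_core_affine` are the ABSTRACT forms (all rings type variables), which the
§17 filtered engine instantiates on the extended Rees algebra with `ConeFibreClause.coneFibreClause` as `hclB`.
-/

set_option linter.dupNamespace false

noncomputable section

open Polynomial Literature.AlgebraicGeometry.Resolution

namespace Summit.ResolutionOfSingularities.ResolutionOfSingularities.Theorems.FInjectiveMacaulayfication.GradedChartClauseAssembly

/-- Transport of the clause (no domain conjunct) between the localisations at corresponding primes along a ring isomorphism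
`e : A ≃+* B` (`Q' = e(Q)`, stated as `e x ∈ Q' ↔ x ∈ Q`). [folklore] -/
theorem clause_atPrime_of_ringEquiv (p : ℕ) {A B : Type} [CommRing A] [CommRing B] (e : A ≃+* B)
    (Q : Ideal A) [Q.IsPrime] (Q' : Ideal B) [Q'.IsPrime] (hQ' : ∀ x : A, e x ∈ Q' ↔ x ∈ Q)
    (h : ∀ d : ℕ, ringKrullDim (Localization.AtPrime Q) = d → ∀ s : Fin d → Localization.AtPrime Q,
      (Ideal.span (Set.range s)).radical.IsMaximal →
        RingTheory.Sequence.IsWeaklyRegular (Localization.AtPrime Q) (List.ofFn s) ∧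
        ∀ y : Localization.AtPrime Q, (∃ e : ℕ, y ^ p ^ e ∈ Ideal.span
          ((fun z : Localization.AtPrime Q => z ^ p ^ e) ''
            (Ideal.span (Set.range s) : Set (Localization.AtPrime Q)))) → y ∈ Ideal.span (Set.range s)) :
    ∀ d : ℕ, ringKrullDim (Localization.AtPrime Q') = d → ∀ s : Fin d → Localization.AtPrime Q',
      (Ideal.span (Set.range s)).radical.IsMaximal →
        RingTheory.Sequence.IsWeaklyRegular (Localization.AtPrime Q') (List.ofFn s) ∧
        ∀ y : Localization.AtPrime Q', (∃ e : ℕ, y ^ p ^ e ∈ Ideal.span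
          ((fun z : Localization.AtPrime Q' => z ^ p ^ e) ''
            (Ideal.span (Set.range s) : Set (Localization.AtPrime Q')))) → y ∈ Ideal.span (Set.range s) := by
  obtain ⟨ε⟩ := BlowupFiModelOfCover.nonempty_ringEquiv_localization_of_ringEquiv e Q Q' hQ'
  exact DegreeZeroDescent.inlineClause_of_ringEquiv p ε h

/-- **ABSTRACT CORE of the G4 assembly** (all rings type variables; the graded engine instantiates `B := T' = L[s]`, `b := s`,
`C₀ := R[I/u]`). Data: a Noetherian `k`-algebra `B` of characteristic `p` whose maximal localisations all have dimension `m`; a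
`k`-subalgebra `A'` over which `B` is integral, with an `A'`-linear retraction `ρ`; `b ∈ B` with `b^N ∈ A'` and the clause for `B` at
its maximal ideals containing `b`; rings `C₀ ≃+* T₀` (`T₀` Noetherian of characteristic `p`), `u₀ ∈ C₀`, and a ring isomorphism
`e : T₀[Y, Y⁻¹] ≃+* A'` with `e⁻¹(b^N) ∈ (ι(u₀)/1)`. Conclusion: the clause for `C₀` at every maximal ideal containing `u₀`. Proof:
finite graded descent (`FiniteGradedDescent.stub_finiteGradedDescent`) ⇒ clause for `A'` at `𝔫' = e(𝔑·T₀[Y, Y⁻¹])`,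
`𝔑 = ι(Q)·T₀[Y] + (Y − 1)` (it contains `b^N`); transport along `e`; Laurent descent (`LaurentDescentAway.laurentDescentAway`); transport
along `ι`. [folklore] -/
theorem chartClause_core (p : ℕ) [Fact p.Prime] (k : Type) [Field k] (B : Type) [CommRing B] [Algebra k B]
    [IsNoetherianRing B] [CharP B p] (m : ℕ)
    (hdimB : ∀ (P : Ideal B) [P.IsMaximal], ringKrullDim (Localization.AtPrime P) = m)
    (A' : Subalgebra k B) [Algebra.IsIntegral A' B] (ρ : B →ₗ[A'] A') (hρ : ∀ x : A', ρ (x : B) = x)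
    (b : B) (N : ℕ) (hbN : b ^ N ∈ A')
    (hclB : ∀ (P : Ideal B) [P.IsMaximal], b ∈ P →
      ∀ d : ℕ, ringKrullDim (Localization.AtPrime P) = d → ∀ s : Fin d → Localization.AtPrime P,
      (Ideal.span (Set.range s)).radical.IsMaximal →
        RingTheory.Sequence.IsWeaklyRegular (Localization.AtPrime P) (List.ofFn s) ∧
        ∀ y : Localization.AtPrime P, (∃ e : ℕ, y ^ p ^ e ∈ Ideal.span
          ((fun z : Localization.AtPrime P => z ^ p ^ e) ''
            (Ideal.span (Set.range s) : Set (Localization.AtPrime P)))) → y ∈ Ideal.span (Set.range s))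
    (C₀ : Type) [CommRing C₀] (T₀ : Type) [CommRing T₀] [IsNoetherianRing T₀] [CharP T₀ p] (ι : C₀ ≃+* T₀)
    (e : Localization.Away (Polynomial.X : Polynomial T₀) ≃+* A') (u₀ : C₀)
    (heN : e.symm ⟨b ^ N, hbN⟩ ∈ Ideal.span {algebraMap (Polynomial T₀)
      (Localization.Away (Polynomial.X : Polynomial T₀)) (Polynomial.C (ι u₀))})
    (Q : Ideal C₀) [Q.IsMaximal] (huQ : u₀ ∈ Q) :
    ∀ d : ℕ, ringKrullDim (Localization.AtPrime Q) = d → ∀ s : Fin d → Localization.AtPrime Q,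
      (Ideal.span (Set.range s)).radical.IsMaximal →
        RingTheory.Sequence.IsWeaklyRegular (Localization.AtPrime Q) (List.ofFn s) ∧
        ∀ y : Localization.AtPrime Q, (∃ e : ℕ, y ^ p ^ e ∈ Ideal.span
          ((fun z : Localization.AtPrime Q => z ^ p ^ e) ''
            (Ideal.span (Set.range s) : Set (Localization.AtPrime Q)))) → y ∈ Ideal.span (Set.range s) := by
  -- finite graded descent along `A' ⊆ B`
  have hdimA : ∀ (𝔫 : Ideal A') [𝔫.IsMaximal], ringKrullDim (Localization.AtPrime 𝔫) = m :=
    IntegralSubalgebraLocalDim.stub_integralSubalgebraLocalDim k B A' m hdimB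
  have hFGD := FiniteGradedDescent.stub_finiteGradedDescent p k B A' ρ hρ b N m hbN hdimB hdimA hclB
  -- `𝔫₀ = ι(Q)`, `𝔑 = 𝔫₀·T₀[Y] + (Y − 1)`, `𝔐 = 𝔑·T₀[Y, Y⁻¹]`, `𝔫' = e(𝔐)` (as preimages under the inverse isomorphisms)
  have hex₀ : ∃ 𝔫₀ : Ideal T₀, 𝔫₀ = Q.comap ι.symm := ⟨_, rfl⟩
  rcases hex₀ with ⟨𝔫₀, h𝔫₀⟩
  haveI : 𝔫₀.IsMaximal := by rw [h𝔫₀]; exact Ideal.comap_isMaximal_of_equiv ι.symm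
  have hmem₀ : ∀ x, ι x ∈ 𝔫₀ ↔ x ∈ Q := fun x => by
    rw [h𝔫₀, Ideal.mem_comap, RingEquiv.symm_apply_apply]
  have hmem₀' : ∀ y, ι.symm y ∈ Q ↔ y ∈ 𝔫₀ := fun y => by
    rw [h𝔫₀, Ideal.mem_comap]
  have hex₁ : ∃ 𝔑 : Ideal (Polynomial T₀),
      𝔑 = 𝔫₀.map (Polynomial.C : T₀ →+* Polynomial T₀) ⊔ Ideal.span {(Polynomial.X - 1 : Polynomial T₀)} := ⟨_, rfl⟩
  rcases hex₁ with ⟨𝔑, h𝔑⟩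
  have hex₂ : ∃ 𝔐 : Ideal (Localization.Away (Polynomial.X : Polynomial T₀)),
      𝔐 = 𝔑.map (algebraMap (Polynomial T₀) (Localization.Away (Polynomial.X : Polynomial T₀))) := ⟨_, rfl⟩
  rcases hex₂ with ⟨𝔐, h𝔐⟩
  haveI : 𝔐.IsMaximal := by rw [h𝔐]; exact LaurentDescentAway.isMaximal_map_away 𝔫₀ 𝔑 h𝔑
  have h𝔐c : 𝔐.comap (algebraMap (Polynomial T₀) (Localization.Away (Polynomial.X : Polynomial T₀))) = 𝔑 := by
    rw [h𝔐]; exact LaurentDescentAway.comap_map_away 𝔫₀ 𝔑 h𝔑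
  have hex₃ : ∃ 𝔫' : Ideal A', 𝔫' = 𝔐.comap e.symm := ⟨_, rfl⟩
  rcases hex₃ with ⟨𝔫', h𝔫'⟩
  haveI : 𝔫'.IsMaximal := by rw [h𝔫']; exact Ideal.comap_isMaximal_of_equiv e.symm
  have hmem' : ∀ x, e.symm x ∈ 𝔐 ↔ x ∈ 𝔫' := fun x => by
    rw [h𝔫', Ideal.mem_comap]
  -- `b^N ∈ 𝔫'`: `e⁻¹(b^N) ∈ (C(ι u₀)/1) ⊆ 𝔐` since `ι u₀ ∈ 𝔫₀`
  have hmem : (⟨b ^ N, hbN⟩ : A') ∈ 𝔫' := by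
    refine (hmem' _).mp ((Ideal.span_singleton_le_iff_mem _).mpr ?_ heN)
    refine (LaurentDescentAway.algebraMap_mem_iff_of_comap_eq 𝔑 𝔐 h𝔐c _).mpr ?_
    have h1 : Polynomial.C (ι u₀) ∈
        𝔫₀.map (Polynomial.C : T₀ →+* Polynomial T₀) ⊔ Ideal.span {(Polynomial.X - 1 : Polynomial T₀)} :=
      Ideal.mem_sup_left (Ideal.mem_map_of_mem _ ((hmem₀ _).mpr huQ))
    rwa [← h𝔑] at h1
  -- clause for `A'_{𝔫'}` ⇒ for `T₀[Y, Y⁻¹]_𝔐` ⇒ for `(T₀)_{𝔫₀}` ⇒ for `(C₀)_Q`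
  have h1 := hFGD 𝔫' hmem
  have h2 := clause_atPrime_of_ringEquiv p e.symm 𝔫' 𝔐 hmem' h1
  have h3 := LaurentDescentAway.laurentDescentAway p T₀ 𝔫₀ 𝔐 (h𝔐c.trans h𝔑) h2
  exact clause_atPrime_of_ringEquiv p ι.symm 𝔫₀ Q hmem₀' h3

/-- **G4 ASSEMBLY modulo the Rees–Veronese interface** (see the module docstring): the clause at every maximal ideal `Q ∋ u` of
the blow-up chart `C = R[I/u]`, `u = x̄_v^c`, `R = k[X]/(f)`, from `hoff` and the interface data: a `k`-subalgebra `A' ≤ T' = L[s]`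
over which `T'` is integral with an `A'`-linear retraction and which contains `s^N`; a ring `T₀` with `ι : C ≃+* T₀`; a ring
isomorphism `e : T₀[Y, Y⁻¹] ≃+* A'` (`T₀[Y, Y⁻¹] = Localization.Away (Y : T₀[Y])`) with `e⁻¹(s^N)` in the ideal `(ι(u)/1)` (in the
graded engine: `T₀` = the degree-`0` part of `T'`, `A'` = `T₀[C(u/1)^{±1}]`, `ι(u) = C(u/1)·s^N`, `e|_{T₀}` = inclusion,
`e(Y) = C(u/1)`, so `e⁻¹(s^N) = ι(u)/Y`). = `chartClause_core` with `B := T'`, `b := s`, `hclB :=` H-G4a, `m := dim T'`. [folklore] -/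
theorem chartClause_of_reesInterface (p : ℕ) [Fact p.Prime] (k : Type) [Field k] [CharP k p] (n : ℕ)
    (f : MvPolynomial (Fin n) k) (hfprime : (Ideal.span {f}).IsPrime) (v : Fin n) (c : ℕ) (hc : 0 < c)
    (hXv : Ideal.Quotient.mk (Ideal.span {f}) (MvPolynomial.X v) ≠ 0)
    (hoff : ∀ (Q : Ideal (MvPolynomial (Fin n) k ⧸ Ideal.span {f})) [Q.IsMaximal],
      (∃ j : Fin n, Ideal.Quotient.mk (Ideal.span {f}) (MvPolynomial.X j) ∉ Q) →
      ∀ d : ℕ, ringKrullDim (Localization.AtPrime Q) = d → ∀ s : Fin d → Localization.AtPrime Q,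
      (Ideal.span (Set.range s)).radical.IsMaximal →
        RingTheory.Sequence.IsWeaklyRegular (Localization.AtPrime Q) (List.ofFn s) ∧
        ∀ y : Localization.AtPrime Q, (∃ e : ℕ, y ^ p ^ e ∈ Ideal.span
          ((fun z : Localization.AtPrime Q => z ^ p ^ e) ''
            (Ideal.span (Set.range s) : Set (Localization.AtPrime Q)))) → y ∈ Ideal.span (Set.range s))
    (I : Ideal (MvPolynomial (Fin n) k ⧸ Ideal.span {f})) (N : ℕ)
    (A' : Subalgebra k (Polynomial (Localization.Away (Ideal.Quotient.mk (Ideal.span {f}) (MvPolynomial.X v) ^ c))))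
    [Algebra.IsIntegral A' (Polynomial (Localization.Away (Ideal.Quotient.mk (Ideal.span {f}) (MvPolynomial.X v) ^ c)))]
    (ρ : (Polynomial (Localization.Away (Ideal.Quotient.mk (Ideal.span {f}) (MvPolynomial.X v) ^ c))) →ₗ[A'] A') (hρ : ∀ x : A', ρ (x : (Polynomial (Localization.Away (Ideal.Quotient.mk (Ideal.span {f}) (MvPolynomial.X v) ^ c)))) = x)
    (hsN : (Polynomial.X : (Polynomial (Localization.Away (Ideal.Quotient.mk (Ideal.span {f}) (MvPolynomial.X v) ^ c)))) ^ N ∈ A')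
    (T₀ : Type) [CommRing T₀] (ι : (blowupAlgebra I (Ideal.Quotient.mk (Ideal.span {f}) (MvPolynomial.X v) ^ c)) ≃+* T₀)
    (e : Localization.Away (Polynomial.X : Polynomial T₀) ≃+* A')
    (heN : e.symm ⟨Polynomial.X ^ N, hsN⟩ ∈ Ideal.span {algebraMap (Polynomial T₀)
      (Localization.Away (Polynomial.X : Polynomial T₀)) (Polynomial.C (ι (algebraMap (MvPolynomial (Fin n) k ⧸ Ideal.span {f}) (blowupAlgebra I (Ideal.Quotient.mk (Ideal.span {f}) (MvPolynomial.X v) ^ c)) (Ideal.Quotient.mk (Ideal.span {f}) (MvPolynomial.X v) ^ c))))})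
    (Q : Ideal (blowupAlgebra I (Ideal.Quotient.mk (Ideal.span {f}) (MvPolynomial.X v) ^ c))) [Q.IsMaximal]
    (huQ : algebraMap (MvPolynomial (Fin n) k ⧸ Ideal.span {f}) (blowupAlgebra I (Ideal.Quotient.mk (Ideal.span {f}) (MvPolynomial.X v) ^ c)) (Ideal.Quotient.mk (Ideal.span {f}) (MvPolynomial.X v) ^ c) ∈ Q) :
    ∀ d : ℕ, ringKrullDim (Localization.AtPrime Q) = d → ∀ s : Fin d → Localization.AtPrime Q,
      (Ideal.span (Set.range s)).radical.IsMaximal →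
        RingTheory.Sequence.IsWeaklyRegular (Localization.AtPrime Q) (List.ofFn s) ∧
        ∀ y : Localization.AtPrime Q, (∃ e : ℕ, y ^ p ^ e ∈ Ideal.span
          ((fun z : Localization.AtPrime Q => z ^ p ^ e) ''
            (Ideal.span (Set.range s) : Set (Localization.AtPrime Q)))) → y ∈ Ideal.span (Set.range s) := by
  -- instances on `R`, `L = R[1/u]`, `T' = L[s]`, `C = R[I/u]`, `T₀`
  haveI := hfprime
  haveI : IsDomain (MvPolynomial (Fin n) k ⧸ Ideal.span {f}) := Ideal.Quotient.isDomain _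
  haveI : CharP (MvPolynomial (Fin n) k ⧸ Ideal.span {f}) p := charP_of_injective_algebraMap (algebraMap k (MvPolynomial (Fin n) k ⧸ Ideal.span {f})).injective p
  have hu : (Ideal.Quotient.mk (Ideal.span {f}) (MvPolynomial.X v) ^ c) ≠ 0 := pow_ne_zero _ hXv
  haveI : IsDomain (Localization.Away (Ideal.Quotient.mk (Ideal.span {f}) (MvPolynomial.X v) ^ c)) := IsLocalization.isDomain_localization (powers_le_nonZeroDivisors_of_noZeroDivisors hu)
  haveI : CharP (Localization.Away (Ideal.Quotient.mk (Ideal.span {f}) (MvPolynomial.X v) ^ c)) p :=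
    charP_of_injective_algebraMap (IsLocalization.injective (Localization.Away (Ideal.Quotient.mk (Ideal.span {f}) (MvPolynomial.X v) ^ c)) (powers_le_nonZeroDivisors_of_noZeroDivisors hu)) p
  haveI : IsNoetherianRing (Localization.Away (Ideal.Quotient.mk (Ideal.span {f}) (MvPolynomial.X v) ^ c)) := Algebra.FiniteType.isNoetherianRing k _
  haveI : Algebra.FiniteType (MvPolynomial (Fin n) k ⧸ Ideal.span {f}) (blowupAlgebra I (Ideal.Quotient.mk (Ideal.span {f}) (MvPolynomial.X v) ^ c)) := finiteType_blowupAlgebra I _ (IsNoetherian.noetherian I)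
  haveI : IsNoetherianRing (blowupAlgebra I (Ideal.Quotient.mk (Ideal.span {f}) (MvPolynomial.X v) ^ c)) := Algebra.FiniteType.isNoetherianRing (MvPolynomial (Fin n) k ⧸ Ideal.span {f}) _
  haveI : IsNoetherianRing T₀ := isNoetherianRing_of_ringEquiv _ ι
  haveI : CharP (blowupAlgebra I (Ideal.Quotient.mk (Ideal.span {f}) (MvPolynomial.X v) ^ c)) p := (algebraMap (blowupAlgebra I (Ideal.Quotient.mk (Ideal.span {f}) (MvPolynomial.X v) ^ c)) (Localization.Away (Ideal.Quotient.mk (Ideal.span {f}) (MvPolynomial.X v) ^ c))).charP Subtype.val_injective p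
  haveI : CharP T₀ p := (ι.symm : T₀ →+* (blowupAlgebra I (Ideal.Quotient.mk (Ideal.span {f}) (MvPolynomial.X v) ^ c))).charP ι.symm.injective p
  -- uniform dimension `m` of the maximal localisations of the affine domain `T'`
  have hex := exists_ringKrullDim_eq_and_trdeg_eq k (Polynomial (Localization.Away (Ideal.Quotient.mk (Ideal.span {f}) (MvPolynomial.X v) ^ c)))
  rcases hex with ⟨m, hm, -⟩
  have hdimB : ∀ (Q' : Ideal (Polynomial (Localization.Away (Ideal.Quotient.mk (Ideal.span {f}) (MvPolynomial.X v) ^ c)))) [Q'.IsMaximal], ringKrullDim (Localization.AtPrime Q') = m := fun Q' _ => by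
    rw [ringKrullDim_localization_atPrime_eq_of_isMaximal k Q', hm]
  exact chartClause_core p k (Polynomial (Localization.Away (Ideal.Quotient.mk (Ideal.span {f}) (MvPolynomial.X v) ^ c))) m hdimB A' ρ hρ Polynomial.X N hsN
    (fun Q' _ hXQ' => (ExceptionalFibreClause.exceptionalFibreClause p k n f hfprime v c hc hXv hoff Q' hXQ').2)
    (blowupAlgebra I (Ideal.Quotient.mk (Ideal.span {f}) (MvPolynomial.X v) ^ c)) T₀ ι e (algebraMap (MvPolynomial (Fin n) k ⧸ Ideal.span {f}) (blowupAlgebra I (Ideal.Quotient.mk (Ideal.span {f}) (MvPolynomial.X v) ^ c)) (Ideal.Quotient.mk (Ideal.span {f}) (MvPolynomial.X v) ^ c)) heN Q huQ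

/-- **ABSTRACT CORE, affine-domain form** — `chartClause_core` for a DOMAIN `B` of finite type over the field `k`: the uniform dimension
`m` of its maximal localisations is supplied by the dimension theorem for affine domains (`Literature…exists_ringKrullDim_eq_and_trdeg_eq`,
`…ringKrullDim_localization_atPrime_eq_of_isMaximal`). This is the form the filtered engine (§17: `B := ℛ(R)[1/x̄'_v]`, `b := s`,
`hclB :=` `ConeFibreClause.coneFibreClause`) and the graded engine (`B := L[s]`) both instantiate. [folklore] -/
theorem chartClause_core_affine (p : ℕ) [Fact p.Prime] (k : Type) [Field k] (B : Type) [CommRing B] [IsDomain B] [Algebra k B]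
    [Algebra.FiniteType k B] [CharP B p]
    (A' : Subalgebra k B) [Algebra.IsIntegral A' B] (ρ : B →ₗ[A'] A') (hρ : ∀ x : A', ρ (x : B) = x)
    (b : B) (N : ℕ) (hbN : b ^ N ∈ A')
    (hclB : ∀ (P : Ideal B) [P.IsMaximal], b ∈ P →
      ∀ d : ℕ, ringKrullDim (Localization.AtPrime P) = d → ∀ s : Fin d → Localization.AtPrime P,
      (Ideal.span (Set.range s)).radical.IsMaximal →
        RingTheory.Sequence.IsWeaklyRegular (Localization.AtPrime P) (List.ofFn s) ∧
        ∀ y : Localization.AtPrime P, (∃ e : ℕ, y ^ p ^ e ∈ Ideal.span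
          ((fun z : Localization.AtPrime P => z ^ p ^ e) ''
            (Ideal.span (Set.range s) : Set (Localization.AtPrime P)))) → y ∈ Ideal.span (Set.range s))
    (C₀ : Type) [CommRing C₀] (T₀ : Type) [CommRing T₀] [IsNoetherianRing T₀] [CharP T₀ p] (ι : C₀ ≃+* T₀)
    (e : Localization.Away (Polynomial.X : Polynomial T₀) ≃+* A') (u₀ : C₀)
    (heN : e.symm ⟨b ^ N, hbN⟩ ∈ Ideal.span {algebraMap (Polynomial T₀)
      (Localization.Away (Polynomial.X : Polynomial T₀)) (Polynomial.C (ι u₀))})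
    (Q : Ideal C₀) [Q.IsMaximal] (huQ : u₀ ∈ Q) :
    ∀ d : ℕ, ringKrullDim (Localization.AtPrime Q) = d → ∀ s : Fin d → Localization.AtPrime Q,
      (Ideal.span (Set.range s)).radical.IsMaximal →
        RingTheory.Sequence.IsWeaklyRegular (Localization.AtPrime Q) (List.ofFn s) ∧
        ∀ y : Localization.AtPrime Q, (∃ e : ℕ, y ^ p ^ e ∈ Ideal.span
          ((fun z : Localization.AtPrime Q => z ^ p ^ e) ''
            (Ideal.span (Set.range s) : Set (Localization.AtPrime Q)))) → y ∈ Ideal.span (Set.range s) := by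
  haveI : IsNoetherianRing B := Algebra.FiniteType.isNoetherianRing k B
  have hex := exists_ringKrullDim_eq_and_trdeg_eq k B
  rcases hex with ⟨m, hm, -⟩
  have hdimB : ∀ (P : Ideal B) [P.IsMaximal], ringKrullDim (Localization.AtPrime P) = m := fun P _ => by
    rw [ringKrullDim_localization_atPrime_eq_of_isMaximal k P, hm]
  exact chartClause_core p k B m hdimB A' ρ hρ b N hbN hclB C₀ T₀ ι e u₀ heN Q huQ

/-- **From the engine's compatibilities to `heN`.** If the Laurent presentation `e : T₀[Y, Y⁻¹] ≃+* A'` satisfies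
`e(C t / 1) = e(Y / 1) · b^N` in `B` for some `t ∈ T₀` (in the graded engine: `t = ι(u)`, `e|_{T₀}` = inclusion, `ι(u) = C(u/1)·s^N`,
`e(Y) = C(u/1)`), then `e⁻¹(b^N) = C(t)/Y` lies in the ideal `(C(t)/1)` — the hypothesis `heN` of `chartClause_core` /
`chartClause_of_reesInterface`. [folklore] -/
theorem symm_pow_mem_span_of_compat {k B T₀ : Type} [Field k] [CommRing B] [Algebra k B] [CommRing T₀]
    (A' : Subalgebra k B) (e : Localization.Away (Polynomial.X : Polynomial T₀) ≃+* A') (t : T₀) (b : B) (N : ℕ)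
    (hbN : b ^ N ∈ A')
    (h : ((e (algebraMap (Polynomial T₀) (Localization.Away (Polynomial.X : Polynomial T₀)) (Polynomial.C t))) : B) =
      ((e (algebraMap (Polynomial T₀) (Localization.Away (Polynomial.X : Polynomial T₀)) Polynomial.X)) : B) * b ^ N) :
    e.symm ⟨b ^ N, hbN⟩ ∈ Ideal.span {algebraMap (Polynomial T₀)
      (Localization.Away (Polynomial.X : Polynomial T₀)) (Polynomial.C t)} := by
  -- in `A'`: `e(C t/1) = e(Y/1) · ⟨b^N⟩`, hence `C t/1 = Y/1 · e⁻¹⟨b^N⟩` in `T₀[Y, Y⁻¹]`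
  have h1 : e (algebraMap (Polynomial T₀) (Localization.Away (Polynomial.X : Polynomial T₀)) (Polynomial.C t)) =
      e (algebraMap (Polynomial T₀) (Localization.Away (Polynomial.X : Polynomial T₀)) Polynomial.X) * ⟨b ^ N, hbN⟩ :=
    Subtype.ext (by rw [Subalgebra.coe_mul]; exact h)
  have h2 : algebraMap (Polynomial T₀) (Localization.Away (Polynomial.X : Polynomial T₀)) (Polynomial.C t) =
      algebraMap (Polynomial T₀) (Localization.Away (Polynomial.X : Polynomial T₀)) Polynomial.X * e.symm ⟨b ^ N, hbN⟩ := by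
    apply e.injective
    rw [map_mul, RingEquiv.apply_symm_apply]
    exact h1
  -- multiply by `Y⁻¹`
  have h3 : e.symm ⟨b ^ N, hbN⟩ =
      algebraMap (Polynomial T₀) (Localization.Away (Polynomial.X : Polynomial T₀)) (Polynomial.C t) *
        IsLocalization.Away.invSelf (Polynomial.X : Polynomial T₀) := by
    rw [h2, mul_comm _ (e.symm _), mul_assoc, IsLocalization.Away.mul_invSelf, mul_one]
  rw [h3]
  exact Ideal.mul_mem_right _ _ (Ideal.subset_span rfl)

end Summit.ResolutionOfSingularities.ResolutionOfSingularities.Theorems.FInjectiveMacaulayfication.GradedChartClauseAssembly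

end
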